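import Summits.HubbardSuperconductivity.HubbardSuperconductivity.Theorems.ThermalWedgeTwSeededEnsembleEquivalenceRTwoPhaseCore
import Summits.HubbardSuperconductivity.HubbardSuperconductivity.Theorems.ThermalWedgeTwSeededEnsembleEquivalenceRColdSlicePackaging
import Summits.HubbardSuperconductivity.HubbardSuperconductivity.Theorems.ThermalWedgeTwSeededEnsembleEquivalenceRColdEdgeSweep
import Summits.HubbardSuperconductivity.HubbardSuperconductivity.Theorems.ThermalWedgeTwSeededEnsembleEquivalenceRNoSplitOfConcavity

/-!
# Reduction theorems: `TwSeededEnsembleEquivalenceR` from s-CONCAVITY of the cold sourced pressure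
# (crux stmt-HubbardSuperconductivity-15581, line `Sketch` v8.4/v8.5; pool seat 0)

With the finite-dimensional two-phase core S7d `stub_twoPhaseCore` LANDED (lead c10,
`…RTwoPhaseCore.lean`), every finite-dimensional stub of line `Sketch` is a theorem, and the crux
`TwSeededEnsembleEquivalenceR` (R) is reduced to ONE statement about the infinite-volume cold sourced pressure
`q(μ, h) = lim_L log Z_L(e^{a/U}; dWaveSourceTorus L U μ h) / (e^{a/U} L²)`. The lead's reduction
(`stub_twR_of_condensation_of_deepUniq`, skeleton v8.5) is `TwSourcedCondensation → DEEP-UNIQ′ → R` (unique optimal source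
modulus among deep maximisers). This file lands the two WEAKER physics interfaces opened by the minimax glue
(`nsc_noSplit_of_concavity`, `nsc_noSplit_of_floor_of_deepConcavity`, p136124), as kernel-checked reductions:

* `twR_of_concavity` : CONC ⟹ R — plain (non-strict) concavity of `s ↦ q(μ, √s)` on the whole squared source box
  `[0, (13g+1)²]`, for interior `μ` of each window; NO use of `TwSourcedCondensation` (stmt-1697): with concavity down to
  `s = 0` no optimiser floor is needed. So R no longer depends on the route item 1697 if the physics input is taken in
  this form.
* `twR_of_fvConcavity` : FV-CONC ⟹ R — the same with concavity of the FINITE-VOLUME cold sourced pressure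
  `s ↦ log Z_L(e^{a/U}; dWaveSourceTorus L U μ √s)/(e^{a/U}L²)` eventually in `L` (the shape a convergent expansion
  delivers: the chord d-wave pair susceptibility `⟨Q_d⟩_{h}/h` of the sourced torus is non-increasing in `h > 0`).
* `twR_of_condensation_of_deepConcavity` : `TwSourcedCondensation` → DEEP-CONC → R — concavity only on the regulated
  deep range `[e^{−a/(2U)}, (13g+1)²]` for all small exponents `a ∈ (0, a₁]` (the quantifier shape of DEEP-UNIQ′, but
  non-strict and without a modulus), the optimiser floor coming from `stub_optimiserFloor hC`.
* `twR_of_condensation_of_fvDeepConcavity` : the same from eventual finite-volume deep concavity.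

Each is the composition `twR_iff_coldSlice.mpr (stub_coldSlicePackaging stub_coldEdgeSweep NOSPLIT stub_twoPhaseCore)`
of LANDED theorems (cold slice …RColdSlice; S7e p141162; S7a p141703; S7d …RTwoPhaseCore; FLOOR p125780; minimax
glue p136012/p136124), with NOSPLIT supplied by concavity instead of FLOOR + DEEP-UNIQ′. Calibration: at `U = 0` CONC
holds for every `β` (`cuq_modeG_strictConcaveOn`, `cal_freeColdUniq`); exact diagonalisation of 8- and 10-site tori
(evidence compute-j021877/j021878/j022168/j022169/j023133 on the item) shows FV-CONC at `U ≤ 2` and level-crossing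
failures at `U ≥ 4`, i.e. CONC is a genuinely weak-coupling input, as the `U ≤ U₀` of the statement requires.
-/

set_option linter.dupNamespace false

namespace Summit.HubbardSuperconductivity.HubbardSuperconductivity.Theorems

open Matrix Finset Literature.MathematicalPhysics.QuantumLattice
open Summit.HubbardSuperconductivity.HubbardSuperconductivity.Theses.ThermalWedge
open Summit.HubbardSuperconductivity.HubbardSuperconductivity.Theorems.TwSeededEnsembleEquivalenceR.ColdFloor
open Summit.HubbardSuperconductivity.HubbardSuperconductivity.Theorems.TwSeededEnsembleEquivalenceR.ColdFloorLine
open scoped ComplexOrder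

noncomputable section

/-- **CONC ⟹ R (no use of `TwSourcedCondensation`).** If on every window `[μ₁, μ₂] ⊂ (−4, 0)` there are
`a, K', U₀ > 0` such that for `U ∈ (0, U₀]`, `g ∈ [K'U, 1/10]`, every pointwise limit `q` of the cold sourced torus
pressure at `β = e^{a/U}` has `s ↦ q(μ, √s)` concave on `[0, (13g+1)²]` for interior `μ`, then
`TwSeededEnsembleEquivalenceR`. (Cold slice ∘ S7e packaging of {S7a edge sweep, NoSplit from CONC by the Ky Fan minimax
glue `nsc_noSplit_of_concavity`, S7d two-phase core}.) [folklore composition] -/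
theorem twR_of_concavity :
    (∀ (μ₁ μ₂ : ℝ), -4 < μ₁ → μ₁ < μ₂ → μ₂ < 0 → ∃ a K' U₀ : ℝ, 0 < a ∧ 0 < K' ∧ 0 < U₀ ∧
      ∀ U ∈ Set.Ioc (0 : ℝ) U₀, ∀ g ∈ Set.Icc (K' * U) (1 / 10), ∀ q : ℝ → ℝ → ℝ,
        (∀ μ ∈ Set.Icc μ₁ μ₂, ∀ h ∈ Set.Icc (-(13 * g + 1)) (13 * g + 1), ∀ κ : ℝ, 0 < κ →
            ∃ L₀ : ℕ, ∀ (L : ℕ) [NeZero L], L₀ ≤ L →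
              |Real.log (Matrix.partitionFn (Real.exp (a / U)) (dWaveSourceTorus L U μ h)).re /
                  (Real.exp (a / U) * (L : ℝ) ^ 2) - q μ h| ≤ κ) →
        ∀ μ ∈ Set.Ioo μ₁ μ₂,
          ConcaveOn ℝ (Set.Icc 0 ((13 * g + 1) ^ 2)) (fun s : ℝ => q μ (Real.sqrt s))) →
    TwSeededEnsembleEquivalenceR :=
  fun hCONC =>
    twR_iff_coldSlice.mpr
      (stub_coldSlicePackaging stub_coldEdgeSweep (nsc_noSplit_of_concavity hCONC) stub_twoPhaseCore)

/-- **FV-CONC ⟹ R (no use of `TwSourcedCondensation`).** As `twR_of_concavity`, with concavity assumed for the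
finite-volume cold sourced pressure `s ↦ log Z_L(e^{a/U}; dWaveSourceTorus L U μ √s) / (e^{a/U} L²)` on
`[0, (13g+1)²]`, eventually in `L`, for interior `μ` (`nsc_concavity_of_finiteVolume`). [folklore composition] -/
theorem twR_of_fvConcavity :
    (∀ (μ₁ μ₂ : ℝ), -4 < μ₁ → μ₁ < μ₂ → μ₂ < 0 → ∃ a K' U₀ : ℝ, 0 < a ∧ 0 < K' ∧ 0 < U₀ ∧
      ∀ U ∈ Set.Ioc (0 : ℝ) U₀, ∀ g ∈ Set.Icc (K' * U) (1 / 10), ∀ μ ∈ Set.Ioo μ₁ μ₂,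
        ∃ L₀ : ℕ, ∀ (L : ℕ) [NeZero L], L₀ ≤ L →
          ConcaveOn ℝ (Set.Icc 0 ((13 * g + 1) ^ 2)) (fun s : ℝ =>
            Real.log (Matrix.partitionFn (Real.exp (a / U)) (dWaveSourceTorus L U μ (Real.sqrt s))).re /
              (Real.exp (a / U) * (L : ℝ) ^ 2))) →
    TwSeededEnsembleEquivalenceR :=
  fun hFV => twR_of_concavity (nsc_concavity_of_finiteVolume hFV)

/-- **`TwSourcedCondensation` + DEEP-CONC ⟹ R.** Concavity of `s ↦ q(μ, √s)` only on the regulated deep range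
`[e^{−a/(2U)}, (13g+1)²]`, for all small exponents `a ∈ (0, a₁]`; the optimiser floor `stub_optimiserFloor hC` (every
maximiser of the cold payoff `h ↦ q(μ,h) − h²/g` is a deep source) and `nsc_noSplit_of_floor_of_deepConcavity` give
NoSplit, then S7e/S7a/S7d as in `twR_of_concavity`. This weakens the lead's reduction
`TwSourcedCondensation → DEEP-UNIQ′ → R` (no uniqueness, strictness or modulus of concavity). [folklore composition] -/
theorem twR_of_condensation_of_deepConcavity :
    TwSourcedCondensation →
    (∀ (μ₁ μ₂ : ℝ), -4 < μ₁ → μ₁ < μ₂ → μ₂ < 0 → ∃ a₁ : ℝ, 0 < a₁ ∧ ∀ a ∈ Set.Ioc (0 : ℝ) a₁,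
      ∃ K' U₀ : ℝ, 0 < K' ∧ 0 < U₀ ∧ ∀ U ∈ Set.Ioc (0 : ℝ) U₀, ∀ g ∈ Set.Icc (K' * U) (1 / 10),
        ∀ q : ℝ → ℝ → ℝ,
          (∀ μ ∈ Set.Icc μ₁ μ₂, ∀ h ∈ Set.Icc (-(13 * g + 1)) (13 * g + 1), ∀ κ : ℝ, 0 < κ →
            ∃ L₀ : ℕ, ∀ (L : ℕ) [NeZero L], L₀ ≤ L →
              |Real.log (Matrix.partitionFn (Real.exp (a / U)) (dWaveSourceTorus L U μ h)).re /
                  (Real.exp (a / U) * (L : ℝ) ^ 2) - q μ h| ≤ κ) →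
          ∀ μ ∈ Set.Ioo μ₁ μ₂,
            ConcaveOn ℝ (Set.Icc (Real.exp (-(a / (2 * U)))) ((13 * g + 1) ^ 2))
              (fun s : ℝ => q μ (Real.sqrt s))) →
    TwSeededEnsembleEquivalenceR :=
  fun hC hDC =>
    twR_iff_coldSlice.mpr
      (stub_coldSlicePackaging stub_coldEdgeSweep
        (nsc_noSplit_of_floor_of_deepConcavity (stub_optimiserFloor hC) hDC) stub_twoPhaseCore)

/-- **`TwSourcedCondensation` + FV-DEEP-CONC ⟹ R.** As `twR_of_condensation_of_deepConcavity`, with deep concavity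
assumed for the finite-volume cold sourced pressure eventually in `L` (`nsc_deepConcavity_of_finiteVolume`).
[folklore composition] -/
theorem twR_of_condensation_of_fvDeepConcavity :
    TwSourcedCondensation →
    (∀ (μ₁ μ₂ : ℝ), -4 < μ₁ → μ₁ < μ₂ → μ₂ < 0 → ∃ a₁ : ℝ, 0 < a₁ ∧ ∀ a ∈ Set.Ioc (0 : ℝ) a₁,
      ∃ K' U₀ : ℝ, 0 < K' ∧ 0 < U₀ ∧ ∀ U ∈ Set.Ioc (0 : ℝ) U₀, ∀ g ∈ Set.Icc (K' * U) (1 / 10),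
        ∀ μ ∈ Set.Ioo μ₁ μ₂, ∃ L₀ : ℕ, ∀ (L : ℕ) [NeZero L], L₀ ≤ L →
          ConcaveOn ℝ (Set.Icc (Real.exp (-(a / (2 * U)))) ((13 * g + 1) ^ 2)) (fun s : ℝ =>
            Real.log (Matrix.partitionFn (Real.exp (a / U)) (dWaveSourceTorus L U μ (Real.sqrt s))).re /
              (Real.exp (a / U) * (L : ℝ) ^ 2))) →
    TwSeededEnsembleEquivalenceR :=
  fun hC hFVD => twR_of_condensation_of_deepConcavity hC (nsc_deepConcavity_of_finiteVolume hFVD)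

end

end Summit.HubbardSuperconductivity.HubbardSuperconductivity.Theorems
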